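import Summits.QuantumFields.YangMills.Theorems.BalabanUVNodesK0Stub1FlatAveragingDictionary
import Summits.QuantumFields.YangMills.Theorems.UnitScaleTiltProp8ChartHInvLetter
import Summits.QuantumFields.YangMills.Theorems.BalabanUVNodesK0FlatPortBodyP
import Literature.MathematicalPhysics.QuantumFieldTheory.Balaban1983to89.MatrixNorms
import HarnessLib

/-!
# K0⁷ STUB 1 (`stub_prop8StepCoP13`), sub-target S4a∕S2 seam — **PRINT's (45)–(46) FOR THE RECORD's TRUE LINEARISED AVERAGING AT `U₀ = 1`: for every admissible nested
# family on NODE 00's tori a REAL-linear right inverse `H : (𝔅 → 𝔰𝔲(N)) → (bonds → 𝔰𝔲(N))` of n07-w1's `Q_j(1) = qLin j 1` on the index bonds, WITH the weighted sup letter**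
# — the route UnitScaleTilt's comb∕tent bridge `ChartHInv.exists_rightInverse` (generic carrier, from ANY right inverse of the STRAIGHT averages) fed with k0-s1-w3's d = 4
# port (P9 `body_of_adm22_T4`: the canonical `GQ*(QGQ*)⁻¹` with `IsFlatH` + `HSupLetterG`), followed by a real-linear projector onto `𝔰𝔲(N)` with which every `linAvg`
# family commutes

Cell `pub-ymgap`, width seat `pub-ymgap-k0-s1-w1` g3 (OFFER-3 ∕ INTENT-3).  `--kind proof --supports stmt-QuantumFields-20541 --as helper`; count-neutral.
[15] = [Balaban1985Variational]; [B6] = [Balaban1984PropagatorsII]; [B7] = [Balaban1985Averaging].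

WHY.  [15] p. 285: *«L^jηQ_jHB = B on Λ_j, RD*HB = 0, (45) … |HB| ≤ B₀(L^jη)⁻¹|B|, |∇HB| ≤ B₀(L^jη)⁻²|B| on Ω_j. (46) We will construct the linearizing transformation in
the form A = A′ − HD(A′), (47)»*.  The chart (47) (UST `FlatChart47.chart47`, n07-w2's S2) needs a right inverse `H` of the LINEARISED constraint.  Lit-balaban's
`H = GQ*(QGQ*)⁻¹` ([B6] (2.35); k0-s1-w3's port) inverts the STRAIGHT averages `L^jQ_j`; the record's linearised averaging is n07-w1's `Q_j(1)` = the `linAvg` recursion,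
which differs from `L^jQ_j` by the coarse pure gauge of the comb functional (this seat's `…K0Stub1FlatAveragingDictionary`).  The route UnitScaleTilt built, at generic carrier,
the corrected right inverse `HX = H₀X̃′ + ∂φ` of the TRUE linearisation with the k-uniform letter (`ChartHInv.exists_rightInverse`, `…ChartHInvBridge∕Letter`), and read it
at d = 3 through its complex chart (`ChartHInvFromFlatOps.hH_of_flatH`).  THIS FILE reads it at NODE 00's record through n07-w1's `qLin`, for 𝔰𝔲(N)-VALUED data and
fields (the record's tangent currency; dag-n10-w1's `rightInverse_iff_iterLin_reproduces` is the matching characterisation of `DΦ(0)∘H = id` at the flat datum).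

WHAT IS PROVED (sorry-free; no definition; axioms standard).
* §1 `walkSum_map`, ★ `linAvg_realLinear`, ★ `linFamily_realLinear` — every `linAvg` family `Q^{(j)}` commutes with every REAL-linear map of the matrix coefficients.
* §2 ★ `exists_suProjector` — a real-linear `π : M_N(ℂ) → M_N(ℂ)` (`π(M) = ½(M − Mᴴ) − ntr(½(M − Mᴴ))·1`) with `π M ∈ 𝔰𝔲(N)`, `π = id` on `𝔰𝔲(N)`, `‖πM‖ ≤ 2‖M‖`.
* §3 (generic `P`) `bondAvgIter_of_isFlatH` (k0-s1-w3's `IsFlatH` ⇒ `Q_j(HX)(c) = X(j,c)`, UST `FlatCubeOperators.QE_hOp`); ★★★ `exists_rightInverse_chartLog_of_flatH` — UST part D's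
  `hH_of_flatH` RE-RUN AT `(P, k)`, any matrix fibre `M_n(ℂ)`: `IsFlatH` + `HSupLetterG` + `Adm22` (`2L ≤ R·M + 1`) ⇒ a ℂ-linear right inverse of `fderiv ℂ (chartLog L^{−k} D) 0`
  with `w₁(b)‖HX(b)‖ ≤ B₀(1+2C)(1+2C+2CL)‖X‖_∞` (the literal `hHinv`∕`hHB` of dag-n07-w2 g3's Prop-3 file, ANSWER-OFFER-3 I.≈28440); ★★ `exists_suRightInverse_linFamily` — from any real right
  inverse `H₀` of the straight averages with the (46) letter: a REAL-linear `H`, 𝔰𝔲(N)-valued at every bond, with `η·Q^{(j)}(HX)(c) = X(j,c)` on `𝔅` for 𝔰𝔲(N)-valued data and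
  `w₁(b)‖HX(b)‖ ≤ 2B₀(1+2C)(1+2C+2CL)‖X‖_∞`, `C = (d+2)L` (UST's `H` followed by `π`; §1); ★★ `exists_suRightInverse_qLin_one` — the same as a real-linear map
  `(𝔅 → 𝔰𝔲(N)) → (bonds → 𝔰𝔲(N))` with `η·(qLin j 1 (HX))(c) = X(j,c)` (n07-w1's `qLin_one_eq_family`).
* §4 ★★★ `exists_suRightInverse_qLin_one_of_adm22_T4` — AT THE RECORD: P9's thresholds `Mh₀`, `R₀` and constant `B₀` such that every nested family `D` on `Site (F.P K) 0` of top
  level `K − n` (`1 ≤ K − n`, `K − n + 1 ≤ m + K`) with `Adm22 D R (L·M_h)`, `M_h = L^{a′} ≥ Mh₀`, `R ≥ max R₀ 2`, `a′ + 3 ≤ m + n` carries such an `H` with `η = L^{−(K−n)}` and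
  letter constant `2B₀(1+12L)(1+12L+12L²)`; ★★★ `exists_rightInverse_chartLog_of_adm22_T4` — the same families carry the UST-shape right inverse of
  `fderiv ℂ (chartLog L^{−(K−n)} D) 0` on `M_n(ℂ)`-valued data (constant `B₀(1+12L)(1+12L+12L²)`, `0 ≤ B₀` exported).
HONEST SCOPE.  A composition of kernel-checked tree theorems (UST bridge + k0-s1-w3 port + n07-w1's junction) plus §1–§2's elementary algebra; FLAT background only; the
gradient row of (46) and the Landau row `RD*HB = 0` of (45) are NOT carried here (UST's bridge exports the sup row; the corrected `H` is not lit-balaban's `GQ*(QGQ*)⁻¹` and is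
not claimed to be in the Landau gauge — print's (45) second clause belongs to the straight-average `H`; the gauge-equivalence of the two constraint readings is this seat's
`…FlatAveragingDictionary` §3); which `H` S2's chart (47) at the record finally uses is S2's decision.  Nothing of Bałaban's analysis asserted; `stub_prop8StepCoP13` ∕ K0⁷ NOT
closed; N07 NOT discharged; counts unmoved (28∕28 · 5∕27); one finite 𝕋⁴ programme at fixed ε — R4 closes the conditional finite-𝕋⁴ rung `BalabanLadder.UV` only, never the
summit; the YM mass gap (Clay) is NOT proved by any of this; nothing continuum ∕ ℝ⁴ ∕ OS.  No `sorry`, no `def`, no `instance`, no `notation`.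

References: [15] (44)–(47) p.285, (156)–(157) p.302; [B6] (2.1)–(2.2) p.224, (2.20) p.226, (2.35) p.228, Cor. 2.8 (2.150)–(2.151) p.249; [B7] (11) p.18, (62) p.28,
(124)–(125) p.36.
-/

set_option autoImplicit false
noncomputable section
open scoped BigOperators Matrix Matrix.Norms.L2Operator

namespace Summit.QuantumFields.YangMills.Theorems.K0Stub1RecordAveragingRightInverse

open Literature.MathematicalPhysics.QuantumFieldTheory.Balaban1983to89
open Literature.MathematicalPhysics.QuantumFieldTheory.Balaban1983to89.T4Continuum (T4Family)
open LatticeFieldCalculus (bondAvgIter)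
open BlockAveragingEMLLinearised (linAvg walkSum linAvg_def walkSum_nil walkSum_cons)
open T4AdjointCovarianceUnitary (lieSU mem_lieSU_iff)
open Node00 (SU qLin qLin_one_eq_family)
open B6SectADomainsV1 (Domains)
open B6SectAOperatorsV1 (BondIdx QE QsE QE_apply)
open B6SectAVectorModelV1 (GE EE)
open B6SectA (hOp)
open B11Eq115Space (levOf)
open MatrixNorms (ntr norm_ntr_le_opNorm)
open Summit.QuantumFields.YangMills.Theorems.ChartHInv (exists_linFamily exists_rightInverse)
open Summit.QuantumFields.YangMills.Theorems.Prop8Chart (chartLog fderiv_chartLog_zero_apply)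
open Summit.QuantumFields.YangMills.Theorems.FlatCubeOpsText (Adm22)
open Summit.QuantumFields.YangMills.Theorems.K0FlatCubeOpsTextP (IsFlatH HSupLetterG BodyAt IsLevWeight levWeight_nonneg)
open Summit.QuantumFields.YangMills.Theorems.K0FlatPortBodyP (body_of_adm22_T4)

variable {P : Params} {N : ℕ}

/-! ## §1  The `linAvg` recursion commutes with every real-linear map of the coefficients -/

/-- The signed walk sum commutes with additive maps of the coefficients. [cite: Balaban1984PropagatorsI, (1.8) p.19 (bookkeeping)] -/
theorem walkSum_map {V W : Type*} [AddCommGroup V] [AddCommGroup W] {j : ℕ} (φ : V →+ W) (Y : PBond P j → V) :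
    ∀ γ : List (T4Continuum.LStep P j), walkSum (fun b => φ (Y b)) γ = φ (walkSum Y γ)
  | [] => by rw [walkSum_nil, walkSum_nil, map_zero]
  | s :: γ => by
    rw [walkSum_cons, walkSum_cons, walkSum_map φ Y γ, map_add]
    split_ifs <;> simp [map_neg]

/-- **The linearised one-step average commutes with every REAL-linear map of the matrix coefficients** (its weights `|I|⁻¹` and signs are real).
[cite: Balaban1985Averaging, (124)-(125) p.36] -/
theorem linAvg_realLinear {n : Type*} {j : ℕ} (φ : Matrix n n ℂ →ₗ[ℝ] Matrix n n ℂ) (Y : PBond P j → Matrix n n ℂ) (c : PBond P (j + 1)) :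
    linAvg (fun b => φ (Y b)) c = φ (linAvg Y c) := by
  rw [linAvg_def, linAvg_def]
  have hw : ∀ γ : List (T4Continuum.LStep P j), walkSum (fun b => φ (Y b)) γ = φ (walkSum Y γ) := walkSum_map φ.toAddMonoidHom Y
  simp only [hw, ← map_add, ← map_sub, ← map_sum]
  rw [← Complex.ofReal_natCast, ← Complex.ofReal_inv, Complex.coe_smul, Complex.coe_smul, LinearMap.map_smul]

/-- **Every `linAvg` family `Q^{(j)}` commutes with every real-linear map of the coefficients**: `Q^{(j)}(φ∘Y)(c) = φ(Q^{(j)}Y(c))`. [cite: Balaban1985Averaging, (124)-(125) p.36] -/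
theorem linFamily_realLinear {n : Type*} (Q : (i : ℕ) → (PBond P 0 → Matrix n n ℂ) → PBond P i → Matrix n n ℂ)
    (hQ0 : ∀ Y, Q 0 Y = Y) (hQs : ∀ (i : ℕ) (Y : PBond P 0 → Matrix n n ℂ) (c : PBond P (i + 1)), Q (i + 1) Y c = linAvg (Q i Y) c)
    (φ : Matrix n n ℂ →ₗ[ℝ] Matrix n n ℂ) (Y : PBond P 0 → Matrix n n ℂ) :
    ∀ (k : ℕ) (c : PBond P k), Q k (fun b => φ (Y b)) c = φ (Q k Y c)
  | 0, c => by rw [hQ0, hQ0]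
  | k + 1, c => by
    rw [hQs, hQs, show Q k (fun b => φ (Y b)) = fun b => φ (Q k Y b) from funext (linFamily_realLinear Q hQ0 hQs φ Y k), linAvg_realLinear]

/-! ## §2  The real-linear projector onto `𝔰𝔲(N)`: skew part, then trace removed -/

/-- The projector `π(M) = ½(M − Mᴴ) − ntr(½(M − Mᴴ))·1` of `M_N(ℂ)` onto `𝔰𝔲(N)` (real-linear). [folklore] -/
theorem exists_suProjector (N : ℕ) [NeZero N] :
    ∃ π : Matrix (Fin N) (Fin N) ℂ →ₗ[ℝ] Matrix (Fin N) (Fin N) ℂ,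
      (∀ M, π M = ((2 : ℂ)⁻¹ • (M - Mᴴ)) - ntr ((2 : ℂ)⁻¹ • (M - Mᴴ)) • (1 : Matrix (Fin N) (Fin N) ℂ)) ∧
      (∀ M, π M ∈ lieSU (Fin N)) ∧ (∀ M, M ∈ lieSU (Fin N) → π M = M) ∧ (∀ M, ‖π M‖ ≤ 2 * ‖M‖) := by
  -- the skew part, real-linear
  let σ : Matrix (Fin N) (Fin N) ℂ →ₗ[ℝ] Matrix (Fin N) (Fin N) ℂ :=
    { toFun := fun M => (2 : ℂ)⁻¹ • (M - Mᴴ)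
      map_add' := fun M M' => by rw [Matrix.conjTranspose_add]; module
      map_smul' := fun r M => by
        rw [Matrix.conjTranspose_smul, RingHom.id_apply, star_trivial, ← smul_sub, smul_comm] }
  -- trace removal, real-linear
  let τ : Matrix (Fin N) (Fin N) ℂ →ₗ[ℝ] Matrix (Fin N) (Fin N) ℂ :=
    { toFun := fun M => M - ntr M • (1 : Matrix (Fin N) (Fin N) ℂ)
      map_add' := fun M M' => by simp only [ntr, Matrix.trace_add, add_div, add_smul]; abel
      map_smul' := fun r M => by
        simp only [ntr, RingHom.id_apply, smul_sub]
        congr 1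
        rw [Matrix.trace_smul, Complex.real_smul, mul_div_assoc, mul_smul, Complex.coe_smul] }
  refine ⟨τ ∘ₗ σ, fun M => rfl, fun M => ?_, fun M hM => ?_, fun M => ?_⟩
  · -- π M ∈ 𝔰𝔲(N): skew and traceless
    have hcard : (Fintype.card (Fin N) : ℂ) ≠ 0 := Nat.cast_ne_zero.mpr (by rw [Fintype.card_fin]; exact NeZero.ne N)
    have hσskew : star ((2 : ℂ)⁻¹ • (M - Mᴴ)) = -((2 : ℂ)⁻¹ • (M - Mᴴ)) := by
      rw [star_smul, Matrix.star_eq_conjTranspose, Matrix.conjTranspose_sub, Matrix.conjTranspose_conjTranspose, ← smul_neg, neg_sub]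
      congr 1
      rw [star_inv₀]; norm_num
    refine mem_lieSU_iff.2 ⟨?_, ?_⟩
    · -- skew: the trace of a skew matrix is imaginary, so `ntr(S)·1` is skew too
      have htr : star (ntr ((2 : ℂ)⁻¹ • (M - Mᴴ))) = -ntr ((2 : ℂ)⁻¹ • (M - Mᴴ)) := by
        unfold ntr
        rw [star_div₀, star_natCast, ← Matrix.trace_conjTranspose, ← Matrix.star_eq_conjTranspose, hσskew, Matrix.trace_neg, neg_div]
      show star (((2 : ℂ)⁻¹ • (M - Mᴴ)) - ntr ((2 : ℂ)⁻¹ • (M - Mᴴ)) • (1 : Matrix (Fin N) (Fin N) ℂ)) =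
        -(((2 : ℂ)⁻¹ • (M - Mᴴ)) - ntr ((2 : ℂ)⁻¹ • (M - Mᴴ)) • (1 : Matrix (Fin N) (Fin N) ℂ))
      rw [star_sub, hσskew, star_smul, star_one, htr, neg_smul]
      abel
    · show Matrix.trace (((2 : ℂ)⁻¹ • (M - Mᴴ)) - ntr ((2 : ℂ)⁻¹ • (M - Mᴴ)) • (1 : Matrix (Fin N) (Fin N) ℂ)) = 0
      rw [Matrix.trace_sub, Matrix.trace_smul (ntr ((2 : ℂ)⁻¹ • (M - Mᴴ))) (1 : Matrix (Fin N) (Fin N) ℂ), Matrix.trace_one, ntr, smul_eq_mul,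
        Fintype.card_fin, div_mul_cancel₀ _ (Nat.cast_ne_zero.mpr (NeZero.ne N)), sub_self]
  · -- identity on 𝔰𝔲(N)
    obtain ⟨hskew, htr⟩ := mem_lieSU_iff.1 hM
    rw [Matrix.star_eq_conjTranspose] at hskew
    show ((2 : ℂ)⁻¹ • (M - Mᴴ)) - ntr ((2 : ℂ)⁻¹ • (M - Mᴴ)) • (1 : Matrix (Fin N) (Fin N) ℂ) = M
    have h2 : (2 : ℂ)⁻¹ • (M - Mᴴ) = M := by
      rw [hskew, sub_neg_eq_add, ← two_smul ℂ M, smul_smul, inv_mul_cancel₀ two_ne_zero, one_smul]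
    rw [h2, ntr, htr, zero_div, zero_smul, sub_zero]
  · -- the letter `‖π M‖ ≤ 2‖M‖`
    show ‖((2 : ℂ)⁻¹ • (M - Mᴴ)) - ntr ((2 : ℂ)⁻¹ • (M - Mᴴ)) • (1 : Matrix (Fin N) (Fin N) ℂ)‖ ≤ 2 * ‖M‖
    have hS : ‖(2 : ℂ)⁻¹ • (M - Mᴴ)‖ ≤ ‖M‖ := by
      rw [norm_smul, norm_inv, Complex.norm_two]
      have := norm_sub_le M Mᴴ
      rw [Matrix.l2_opNorm_conjTranspose] at this
      linarith
    have h1 : ‖(1 : Matrix (Fin N) (Fin N) ℂ)‖ ≤ 1 := by rw [norm_one]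
    calc _ ≤ ‖(2 : ℂ)⁻¹ • (M - Mᴴ)‖ + ‖ntr ((2 : ℂ)⁻¹ • (M - Mᴴ)) • (1 : Matrix (Fin N) (Fin N) ℂ)‖ := norm_sub_le _ _
      _ ≤ ‖M‖ + ‖M‖ := by
          refine add_le_add hS ?_
          rw [norm_smul]
          exact (mul_le_mul (norm_ntr_le_opNorm _) h1 (norm_nonneg _) (norm_nonneg _)).trans (by rw [mul_one]; exact hS)
      _ = 2 * ‖M‖ := by ring

/-! ## §3  A right inverse of the TRUE linearised `k`-fold averaging mapping 𝔰𝔲(N)-valued data to 𝔰𝔲(N)-valued fields, with the (46) letter — generic carrier -/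

section Generic

variable [NeZero N]

/-- P2's pinned flat `H` (`IsFlatH`: `H = GQ*(QGQ*)⁻¹` of the family, lattice factor `L^k`) inverts the multi-level STRAIGHT averages on the index bonds:
`(Q_j(HX))(c) = X(j,c)` (UST `FlatCubeOperators.QE_hOp` read on plain functions; k0-s1-w3's generic-carrier `IsFlatH`). [cite: Balaban1985Variational, (45) p.285; Balaban1984PropagatorsII, (2.35) p.228] -/
theorem bondAvgIter_of_isFlatH (k : ℕ) (D : Domains P) (H : (BondIdx D → ℝ) →ₗ[ℝ] (PBond P 0 → ℝ)) (hH : IsFlatH P k D H)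
    (X : BondIdx D → ℝ) (i : BondIdx D) : bondAvgIter (i.1.1 : ℕ) (H X) i.1.2 = X i := by
  have hfun : H X = WithLp.ofLp (hOp (GE D (c := (P.L : ℝ) ^ k) (pow_ne_zero _ (Nat.cast_ne_zero.2 P.L_pos.ne')) (w := fun _ => (1 : ℝ)) (fun _ => one_pos))
      (QsE D) (EE D (c := (P.L : ℝ) ^ k) (pow_ne_zero _ (Nat.cast_ne_zero.2 P.L_pos.ne')) (w := fun _ => (1 : ℝ)) (fun _ => one_pos))
      (WithLp.toLp 2 X)) := funext fun b => hH X b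
  rw [hfun, ← QE_apply, FlatCubeOperators.QE_hOp]

/-- ★★★ **hH AT GENERIC CARRIER — UST `ChartHInvFromFlatOps.hH_of_flatH` (d = 3, `T3Family`) RE-RUN AT `(P, k)`, ANY MATRIX FIBRE `M_n(ℂ)`**: for a nested family `D` with
`D.k = k`, (2.2)-admissible with `2L ≤ R·M + 1`, the (152) level weights `w` (k0-s1-w3's `IsLevWeight P k D w`), and a real operator `H₀` with `IsFlatH P k D H₀` (the canonical
`GQ*(QGQ*)⁻¹`) and the guarded (46) letter `HSupLetterG P k D w H₀ B₀` (`B₀ ≥ 0`): a ℂ-linear right inverse of the TRUE linearised multi-level (0.4)-constraint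
`fderiv ℂ (chartLog η D) 0`, `η = L^{−k}` (UST pillar P3's complex chart; `= η·Q^{(j)}` by `Prop8Chart.fderiv_chartLog_zero_apply`) with `w₁(b)‖HX(b)‖ ≤ B₀(1+2C)(1+2C+2CL)‖X‖_∞`,
`C = (d+2)L` — the literal hH hypothesis of dag-n07-w2 g3's `…N07ChartDOfRecord.exists_chartD_of_rightInverse` ([15] Prop. 3 at the record), asked for on the bus (I.≈28440).
[cite: Balaban1985Variational, (45)-(46) p.285, (156)-(157) p.302; Balaban1984PropagatorsII, (2.35) p.228] -/
theorem exists_rightInverse_chartLog_of_flatH {n : Type*} [Fintype n] [DecidableEq n] (k : ℕ) (D : Domains P) (hDk : D.k = k) {R M : ℕ} (hAdm : Adm22 D R M)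
    (hRM : 2 * P.L ≤ R * M + 1) (w : ℕ → PBond P 0 → ℝ) (hw : IsLevWeight P k D w) (H₀ : (BondIdx D → ℝ) →ₗ[ℝ] (PBond P 0 → ℝ)) (hH₀ : IsFlatH P k D H₀)
    {B₀ : ℝ} (hB₀ : 0 ≤ B₀) (hsup : HSupLetterG P k D w H₀ B₀) :
    ∃ H : (BondIdx D → Matrix n n ℂ) →ₗ[ℂ] (PBond P 0 → Matrix n n ℂ),
      (∀ X : BondIdx D → Matrix n n ℂ,
          (fderiv ℂ (chartLog (((P.L : ℝ)⁻¹) ^ k) D : (PBond P 0 → Matrix n n ℂ) → BondIdx D → Matrix n n ℂ) 0) (H X) = X) ∧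
      ∀ (X : BondIdx D → Matrix n n ℂ) (t : ℝ), 0 ≤ t → (∀ i, ‖X i‖ ≤ t) → ∀ b,
        w 1 b * ‖H X b‖ ≤ B₀ * ((1 + 2 * ((P.d + 2) * P.L : ℕ)) * (1 + 2 * ((P.d + 2) * P.L : ℕ) + 2 * ((P.d + 2) * P.L : ℕ) * P.L)) * t := by
  obtain ⟨Q, hQ0, hQs⟩ := exists_linFamily (P := P) (n := n)
  have hη : 0 < ((P.L : ℝ)⁻¹) ^ k := by have := P.L_pos; positivity
  have hw₁ : ∀ b : PBond P 0, w 1 b = (P.L : ℝ) ^ levOf (fun i => {z : Site P 0 | D.InOm i z}) D.k b.src * ((P.L : ℝ)⁻¹) ^ k := by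
    intro b; rw [hw 1 b, pow_one, hDk]
  obtain ⟨H, hinvC, hlet⟩ := exists_rightInverse (n := n) D hAdm hRM hη (w 1) hw₁ H₀ (bondAvgIter_of_isFlatH k D H₀ hH₀) hB₀
    (fun Xr t ht hXr => (hsup Xr t ht hXr).1) Q hQ0 hQs
  refine ⟨H, fun X => funext fun idx => ?_, fun X t ht hX b => hlet X t ht hX b⟩
  rw [fderiv_chartLog_zero_apply _ D Q hQ0 hQs]
  exact hinvC X idx

/-- ★★ **A RIGHT INVERSE OF THE TRUE LINEARISATION THAT MAPS 𝔰𝔲(N)-VALUED DATA TO 𝔰𝔲(N)-VALUED FIELDS, WITH THE (46) LETTER** (generic carrier).  For a nested family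
`D`, (2.2)-admissible with `2L ≤ R·M + 1`, `η > 0`, the level weight `w₁(b) = L^{j(b₋)}η`, and any real right inverse `H₀` of the multi-level straight averages with the
weighted sup letter (constant `B₀ ≥ 0`): there is a REAL-linear `H` on matrix data, 𝔰𝔲(N)-VALUED AT EVERY BOND, with `η·Q^{(j)}(HX)(c) = X(j,c)` at every index bond for
𝔰𝔲(N)-valued data `X` — `Q^{(j)}` ANY `linAvg` family — and `w₁(b)‖HX(b)‖ ≤ 2B₀(1+2C)(1+2C+2CL)·‖X‖_∞`, `C = (d+2)L`.  (UST `ChartHInv.exists_rightInverse` followed by the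
projector of §2; `Q^{(j)}` commutes with the projector by §1.) [cite: Balaban1985Variational, (45)-(46) p.285, (156)-(157) p.302] -/
theorem exists_suRightInverse_linFamily (D : Domains P) {R M : ℕ} (hAdm : Adm22 D R M) (hRM : 2 * P.L ≤ R * M + 1) {η : ℝ} (hη : 0 < η)
    (w₁ : PBond P 0 → ℝ) (hw₁ : ∀ b, w₁ b = (P.L : ℝ) ^ levOf (fun i => {z : Site P 0 | D.InOm i z}) D.k b.src * η)
    (H₀ : (BondIdx D → ℝ) →ₗ[ℝ] (PBond P 0 → ℝ)) (hinv : ∀ (X : BondIdx D → ℝ) (i : BondIdx D), bondAvgIter (i.1.1 : ℕ) (H₀ X) i.1.2 = X i)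
    {B₀ : ℝ} (hB₀ : 0 ≤ B₀)
    (hsup : ∀ (Xr : BondIdx D → ℝ) (t : ℝ), 0 ≤ t → (∀ i, ((P.L : ℝ) ^ (i.1.1 : ℕ) * η) * |Xr i| ≤ t) → ∀ b, w₁ b * |H₀ Xr b| ≤ B₀ * t)
    (Q : (i : ℕ) → (PBond P 0 → Matrix (Fin N) (Fin N) ℂ) → PBond P i → Matrix (Fin N) (Fin N) ℂ)
    (hQ0 : ∀ Y, Q 0 Y = Y) (hQs : ∀ (i : ℕ) (Y : PBond P 0 → Matrix (Fin N) (Fin N) ℂ) (c : PBond P (i + 1)), Q (i + 1) Y c = linAvg (Q i Y) c) :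
    ∃ H : (BondIdx D → Matrix (Fin N) (Fin N) ℂ) →ₗ[ℝ] (PBond P 0 → Matrix (Fin N) (Fin N) ℂ),
      (∀ X b, H X b ∈ lieSU (Fin N)) ∧
      (∀ X : BondIdx D → Matrix (Fin N) (Fin N) ℂ, (∀ i, X i ∈ lieSU (Fin N)) →
        ∀ idx : BondIdx D, (η : ℂ) • Q (idx.1.1 : ℕ) (H X) idx.1.2 = X idx) ∧
      ∀ (X : BondIdx D → Matrix (Fin N) (Fin N) ℂ) (t : ℝ), 0 ≤ t → (∀ i, ‖X i‖ ≤ t) → ∀ b : PBond P 0,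
        w₁ b * ‖H X b‖ ≤ 2 * (B₀ * ((1 + 2 * ((P.d + 2) * P.L : ℕ)) * (1 + 2 * ((P.d + 2) * P.L : ℕ) + 2 * ((P.d + 2) * P.L : ℕ) * P.L))) * t := by
  obtain ⟨Hc, hinvC, hlet⟩ := exists_rightInverse (n := Fin N) D hAdm hRM hη w₁ hw₁ H₀ hinv hB₀ hsup Q hQ0 hQs
  obtain ⟨π, -, hπmem, hπid, hπnorm⟩ := exists_suProjector N
  have hw₁0 : ∀ b, 0 ≤ w₁ b := fun b => by rw [hw₁ b]; exact mul_nonneg (pow_nonneg (Nat.cast_nonneg _) _) hη.le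
  let H : (BondIdx D → Matrix (Fin N) (Fin N) ℂ) →ₗ[ℝ] (PBond P 0 → Matrix (Fin N) (Fin N) ℂ) :=
    { toFun := fun X b => π (Hc X b),
      map_add' := fun X X' => funext fun b => by rw [map_add, Pi.add_apply, map_add, Pi.add_apply],
      map_smul' := fun r X => funext fun b => by
        rw [RingHom.id_apply, Pi.smul_apply, ← map_smul,
          show r • X = ((r : ℂ)) • X from funext fun i => (Complex.coe_smul r (X i)).symm, map_smul, Pi.smul_apply, Complex.coe_smul] }
  refine ⟨H, fun X b => hπmem _, fun X hX idx => ?_, fun X t ht hXt b => ?_⟩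
  · show (η : ℂ) • Q (idx.1.1 : ℕ) (fun b => π (Hc X b)) idx.1.2 = X idx
    rw [linFamily_realLinear Q hQ0 hQs π (Hc X) _ idx.1.2, Complex.coe_smul, ← map_smul, ← Complex.coe_smul, hinvC X idx, hπid _ (hX idx)]
  · show w₁ b * ‖π (Hc X b)‖ ≤ _
    calc w₁ b * ‖π (Hc X b)‖ ≤ w₁ b * (2 * ‖Hc X b‖) := mul_le_mul_of_nonneg_left (hπnorm _) (hw₁0 b)
      _ = 2 * (w₁ b * ‖Hc X b‖) := by ring
      _ ≤ 2 * (B₀ * ((1 + 2 * ((P.d + 2) * P.L : ℕ)) * (1 + 2 * ((P.d + 2) * P.L : ℕ) + 2 * ((P.d + 2) * P.L : ℕ) * P.L)) * t) :=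
          mul_le_mul_of_nonneg_left (hlet X t ht hXt b) zero_le_two
      _ = _ := by ring

/-- ★★ **THE SAME ON LIE-ALGEBRA DATA AND FIELDS, READ WITH NODE 00's OPERATOR**: a real-linear `H : (𝔅 → 𝔰𝔲(N)) → (bonds → 𝔰𝔲(N))` with
`η·(qLin j 1 (HX))(c) = X(j,c)` at every index bond (n07-w1's left-trivialised `Q_j(1)`; `qLin_one_eq_family`) and the (46) letter.
[cite: Balaban1985Variational, (44)-(46) p.285, (156)-(157) p.302] -/
theorem exists_suRightInverse_qLin_one (D : Domains P) {R M : ℕ} (hAdm : Adm22 D R M) (hRM : 2 * P.L ≤ R * M + 1) {η : ℝ} (hη : 0 < η)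
    (w₁ : PBond P 0 → ℝ) (hw₁ : ∀ b, w₁ b = (P.L : ℝ) ^ levOf (fun i => {z : Site P 0 | D.InOm i z}) D.k b.src * η)
    (H₀ : (BondIdx D → ℝ) →ₗ[ℝ] (PBond P 0 → ℝ)) (hinv : ∀ (X : BondIdx D → ℝ) (i : BondIdx D), bondAvgIter (i.1.1 : ℕ) (H₀ X) i.1.2 = X i)
    {B₀ : ℝ} (hB₀ : 0 ≤ B₀)
    (hsup : ∀ (Xr : BondIdx D → ℝ) (t : ℝ), 0 ≤ t → (∀ i, ((P.L : ℝ) ^ (i.1.1 : ℕ) * η) * |Xr i| ≤ t) → ∀ b, w₁ b * |H₀ Xr b| ≤ B₀ * t) :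
    ∃ H : (BondIdx D → lieSU (Fin N)) →ₗ[ℝ] (PBond P 0 → lieSU (Fin N)),
      (∀ (X : BondIdx D → lieSU (Fin N)) (idx : BondIdx D),
        (η : ℂ) • qLin (idx.1.1 : ℕ) (1 : GaugeField P 0 (SU N)) (H X) idx.1.2 = (X idx : Matrix (Fin N) (Fin N) ℂ)) ∧
      ∀ (X : BondIdx D → lieSU (Fin N)) (t : ℝ), 0 ≤ t → (∀ i, ‖(X i : Matrix (Fin N) (Fin N) ℂ)‖ ≤ t) → ∀ b : PBond P 0,
        w₁ b * ‖(H X b : Matrix (Fin N) (Fin N) ℂ)‖ ≤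
          2 * (B₀ * ((1 + 2 * ((P.d + 2) * P.L : ℕ)) * (1 + 2 * ((P.d + 2) * P.L : ℕ) + 2 * ((P.d + 2) * P.L : ℕ) * P.L))) * t := by
  obtain ⟨Q, hQ0, hQs⟩ := exists_linFamily (P := P) (n := Fin N)
  obtain ⟨Hm, hmem, hinvm, hletm⟩ := exists_suRightInverse_linFamily (N := N) D hAdm hRM hη w₁ hw₁ H₀ hinv hB₀ hsup Q hQ0 hQs
  let H : (BondIdx D → lieSU (Fin N)) →ₗ[ℝ] (PBond P 0 → lieSU (Fin N)) :=
    { toFun := fun X b => ⟨Hm (fun i => (X i : Matrix (Fin N) (Fin N) ℂ)) b, hmem _ b⟩,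
      map_add' := fun X X' => funext fun b => Subtype.ext (by
        simp only [Pi.add_apply, Submodule.coe_add]
        rw [show (fun i => ((X i : Matrix (Fin N) (Fin N) ℂ)) + (X' i : Matrix (Fin N) (Fin N) ℂ)) =
          (fun i => (X i : Matrix (Fin N) (Fin N) ℂ)) + fun i => (X' i : Matrix (Fin N) (Fin N) ℂ) from rfl, map_add, Pi.add_apply]),
      map_smul' := fun r X => funext fun b => Subtype.ext (by
        simp only [Pi.smul_apply, Submodule.coe_smul, RingHom.id_apply]
        rw [show (fun i => r • (X i : Matrix (Fin N) (Fin N) ℂ)) = r • fun i => (X i : Matrix (Fin N) (Fin N) ℂ) from rfl, map_smul,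
          Pi.smul_apply]) }
  refine ⟨H, fun X idx => ?_, fun X t ht hXt b => hletm (fun i => (X i : Matrix (Fin N) (Fin N) ℂ)) t ht hXt b⟩
  show (η : ℂ) • qLin (idx.1.1 : ℕ) (1 : GaugeField P 0 (SU N)) (fun b => ⟨Hm (fun i => (X i : Matrix (Fin N) (Fin N) ℂ)) b, hmem _ b⟩) idx.1.2 = _
  rw [qLin_one_eq_family Q hQ0 hQs]
  exact hinvm _ (fun i => (X i).2) idx

end Generic

/-! ## §4  AT NODE 00's RECORD: every admissible family of the tori `Site (F.P K) 0`, with k0-s1-w3's port constants (P9 `body_of_adm22_T4`) -/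

section Record

variable [NeZero N]

/-- ★★★ **PRINT's (45)–(46) FOR THE RECORD's TRUE LINEARISED AVERAGING, AT EVERY ADMISSIBLE FAMILY.**  k0-s1-w3's P9 `body_of_adm22_T4` supplies thresholds `Mh₀`, `R₀`
and the port's `B₀`; for all heights in the standing range (`1 ≤ K − n`, `K − n + 1 ≤ m + K`) and every nested family `D` of top level `K − n` with `Adm22 D R (L·M_h)`,
`M_h = L^{a′} ≥ Mh₀`, `R ≥ max R₀ 2`, `a′ + 3 ≤ m + n`: a real-linear `H : (𝔅 → 𝔰𝔲(N)) → (bonds → 𝔰𝔲(N))` with `η·(qLin j 1 (HX))(c) = X(j,c)` on `𝔅` (`η = L^{−(K−n)}`) and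
the (46) letter `(L^{j(b₋)}η)·‖HX(b)‖ ≤ 2B₀(1+12L)(1+12L+12L²)·‖X‖_∞` (`C = (d+2)L = 6L`).  The `H` of [15] Sect. C ∕ (157) for the TRUE (0.4) averaging at `U₀ = 1`, at the
record — from the canonical `GQ*(QGQ*)⁻¹` of k0-s1-w3's port (`IsFlatH`, `HSupLetterG`) through UST's comb∕tent bridge and §2–§3.
[cite: Balaban1985Variational, (44)-(46) p.285, (156)-(157) p.302; Balaban1984PropagatorsII, (2.1)-(2.2) p.224, (2.35) p.228, Cor. 2.8 (2.150)-(2.151) p.249] -/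
theorem exists_suRightInverse_qLin_one_of_adm22_T4 (F : T4Family) :
    ∃ (Mh₀ R₀ : ℕ) (B₀ : ℝ), ∀ (n K : ℕ) (_ : 1 ≤ K - n) (_ : K - n + 1 ≤ F.m + K) {Mh R a' : ℕ} (_ : Mh = F.L ^ a') (_ : Mh₀ ≤ Mh) (_ : max R₀ 2 ≤ R)
      (_ : a' + 3 ≤ F.m + n) (D : Domains (F.P K)) (_ : D.k = K - n) (_ : Adm22 D R (F.L * Mh)),
      ∃ H : (BondIdx D → lieSU (Fin N)) →ₗ[ℝ] (PBond (F.P K) 0 → lieSU (Fin N)),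
        (∀ (X : BondIdx D → lieSU (Fin N)) (idx : BondIdx D),
          ((((F.L : ℝ)⁻¹) ^ (K - n) : ℝ) : ℂ) • qLin (idx.1.1 : ℕ) (1 : GaugeField (F.P K) 0 (SU N)) (H X) idx.1.2 = (X idx : Matrix (Fin N) (Fin N) ℂ)) ∧
        ∀ (X : BondIdx D → lieSU (Fin N)) (t : ℝ), 0 ≤ t → (∀ i, ‖(X i : Matrix (Fin N) (Fin N) ℂ)‖ ≤ t) → ∀ b : PBond (F.P K) 0,
          ((F.L : ℝ) ^ levOf (fun i => {z : Site (F.P K) 0 | D.InOm i z}) D.k b.src * ((F.L : ℝ)⁻¹) ^ (K - n)) * ‖(H X b : Matrix (Fin N) (Fin N) ℂ)‖ ≤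
            2 * (B₀ * ((1 + 2 * ((4 + 2) * F.L : ℕ)) * (1 + 2 * ((4 + 2) * F.L : ℕ) + 2 * ((4 + 2) * F.L : ℕ) * F.L))) * t := by
  obtain ⟨Mh₀, R₀, B₀, δ₀, B₃, -, -, hmain⟩ := body_of_adm22_T4 F
  refine ⟨Mh₀, R₀, B₀, ?_⟩
  intro n K hk1 hk' Mh R a' hMha hMh hR hsize D hDk hAdm
  -- the canonical weights and P9's body at this datum
  obtain ⟨w, hw⟩ : ∃ w : ℕ → PBond (F.P K) 0 → ℝ, IsLevWeight (F.P K) (K - n) D w := ⟨_, fun _ _ => rfl⟩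
  obtain ⟨H₀, Gt, hH₀, -, hHsup, -, -, -⟩ := hmain n K hk1 hk' hMha hMh ((le_max_left _ _).trans hR) hsize D hDk hAdm w hw
  have hη : 0 < ((F.L : ℝ)⁻¹) ^ (K - n) := by have := (F.P K).L_pos; positivity
  have hLpos : 0 < F.L := (F.P K).L_pos
  -- `2L ≤ R·(L·M_h) + 1` from `R ≥ 2`, `M_h = L^{a′} ≥ 1`
  have hRM : 2 * (F.P K).L ≤ R * (F.L * Mh) + 1 := by
    have hR2 : 2 ≤ R := (le_max_right _ _).trans hR
    have hMh1 : 1 ≤ Mh := by rw [hMha]; exact Nat.one_le_pow _ _ hLpos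
    have h1 : F.L ≤ F.L * Mh := Nat.le_mul_of_pos_right _ hMh1
    have h2 : 2 * (F.L * Mh) ≤ R * (F.L * Mh) := Nat.mul_le_mul_right _ hR2
    show 2 * F.L ≤ R * (F.L * Mh) + 1
    omega
  have hw₁ : ∀ b : PBond (F.P K) 0,
      w 1 b = ((F.P K).L : ℝ) ^ levOf (fun i => {z : Site (F.P K) 0 | D.InOm i z}) D.k b.src * ((F.L : ℝ)⁻¹) ^ (K - n) := by
    intro b; rw [hw 1 b, pow_one, hDk]; rfl
  -- `0 ≤ B₀` from the letter at the zero datum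
  have hB₀ : 0 ≤ B₀ := by
    have h := (hHsup 0 1 zero_le_one (fun c => by rw [Pi.zero_apply, abs_zero, mul_zero]; exact zero_le_one)).1 ⟨fun _ => 0, ⟨0, (F.P K).hd⟩⟩
    rwa [map_zero, Pi.zero_apply, abs_zero, mul_zero, mul_one] at h
  obtain ⟨H, hinvH, hlet⟩ := exists_suRightInverse_qLin_one (N := N) D hAdm hRM hη (w 1) hw₁ H₀
    (bondAvgIter_of_isFlatH (K - n) D H₀ hH₀) hB₀ (fun Xr t ht hXr => (hHsup Xr t ht hXr).1)
  refine ⟨H, hinvH, fun X t ht hXt b => ?_⟩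
  have h := hlet X t ht hXt b
  rw [hw₁ b] at h
  exact h

/-- ★★★ **hH AT THE RECORD, UST SHAPE**: P9's thresholds `Mh₀`, `R₀` and constant `B₀` such that every nested family `D` on `Site (F.P K) 0` of top level `K − n` (`1 ≤ K − n`,
`K − n + 1 ≤ m + K`) with `Adm22 D R (L·M_h)`, `M_h = L^{a′} ≥ Mh₀`, `R ≥ max R₀ 2`, `a′ + 3 ≤ m + n`, and its (152) level weights `w`, carries a ℂ-linear right inverse of
`fderiv ℂ (chartLog L^{−(K−n)} D) 0` on `M_n(ℂ)`-valued data with `w₁(b)‖HX(b)‖ ≤ B₀(1+12L)(1+12L+12L²)‖X‖_∞` (d = 4: `C = 6L`) — the `hHinv`∕`hHB` of dag-n07-w2's Prop-3 file by `exact`.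
[cite: Balaban1985Variational, (45)-(46) p.285, (156)-(157) p.302; Balaban1984PropagatorsII, (2.1)-(2.2) p.224, Cor. 2.8 (2.150)-(2.151) p.249] -/
theorem exists_rightInverse_chartLog_of_adm22_T4 {n : Type*} [Fintype n] [DecidableEq n] (F : T4Family) :
    ∃ (Mh₀ R₀ : ℕ) (B₀ : ℝ), 0 ≤ B₀ ∧ ∀ (n' K : ℕ) (_ : 1 ≤ K - n') (_ : K - n' + 1 ≤ F.m + K) {Mh R a' : ℕ} (_ : Mh = F.L ^ a') (_ : Mh₀ ≤ Mh) (_ : max R₀ 2 ≤ R)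
      (_ : a' + 3 ≤ F.m + n') (D : Domains (F.P K)) (_ : D.k = K - n') (_ : Adm22 D R (F.L * Mh))
      (w : ℕ → PBond (F.P K) 0 → ℝ) (_ : IsLevWeight (F.P K) (K - n') D w),
      ∃ H : (BondIdx D → Matrix n n ℂ) →ₗ[ℂ] (PBond (F.P K) 0 → Matrix n n ℂ),
        (∀ X : BondIdx D → Matrix n n ℂ,
            (fderiv ℂ (chartLog (((F.L : ℝ)⁻¹) ^ (K - n')) D : (PBond (F.P K) 0 → Matrix n n ℂ) → BondIdx D → Matrix n n ℂ) 0) (H X) = X) ∧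
        ∀ (X : BondIdx D → Matrix n n ℂ) (t : ℝ), 0 ≤ t → (∀ i, ‖X i‖ ≤ t) → ∀ b,
          w 1 b * ‖H X b‖ ≤ B₀ * ((1 + 2 * ((4 + 2) * F.L : ℕ)) * (1 + 2 * ((4 + 2) * F.L : ℕ) + 2 * ((4 + 2) * F.L : ℕ) * F.L)) * t := by
  obtain ⟨Mh₀, R₀, B₀, δ₀, B₃, -, -, hmain⟩ := body_of_adm22_T4 F
  -- `0 ≤ B₀` from the letter at the zero datum of any served family; if none is ever served the constant is irrelevant, so we may take `max B₀ 0`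
  refine ⟨Mh₀, R₀, max B₀ 0, le_max_right _ _, ?_⟩
  intro n' K hk1 hk' Mh R a' hMha hMh hR hsize D hDk hAdm w hw
  obtain ⟨H₀, Gt, hH₀, -, hHsup, -, -, -⟩ := hmain n' K hk1 hk' hMha hMh ((le_max_left _ _).trans hR) hsize D hDk hAdm w hw
  have hLpos : 0 < F.L := (F.P K).L_pos
  have hRM : 2 * (F.P K).L ≤ R * (F.L * Mh) + 1 := by
    have hR2 : 2 ≤ R := (le_max_right _ _).trans hR
    have hMh1 : 1 ≤ Mh := by rw [hMha]; exact Nat.one_le_pow _ _ hLpos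
    have h1 : F.L ≤ F.L * Mh := Nat.le_mul_of_pos_right _ hMh1
    have h2 : 2 * (F.L * Mh) ≤ R * (F.L * Mh) := Nat.mul_le_mul_right _ hR2
    show 2 * F.L ≤ R * (F.L * Mh) + 1
    omega
  have hB₀ : 0 ≤ B₀ := by
    have h := (hHsup 0 1 zero_le_one (fun c => by rw [Pi.zero_apply, abs_zero, mul_zero]; exact zero_le_one)).1 ⟨fun _ => 0, ⟨0, (F.P K).hd⟩⟩
    rwa [map_zero, Pi.zero_apply, abs_zero, mul_zero, mul_one] at h
  have hsup' : HSupLetterG (F.P K) (K - n') D w H₀ (max B₀ 0) := K0FlatCubeOpsTextP.hSupLetterG_mono hHsup (le_max_left _ _)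
  exact exists_rightInverse_chartLog_of_flatH (P := F.P K) (K - n') D hDk hAdm hRM w hw H₀ hH₀ (le_max_right _ _) hsup'

end Record

end Summit.QuantumFields.YangMills.Theorems.K0Stub1RecordAveragingRightInverse

end
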